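import Literature.MathematicalPhysics.QuantumFieldTheory.Balaban1983to89.B9Thm313WholeCutLettersGXHAtPinsT
import Literature.MathematicalPhysics.QuantumFieldTheory.Balaban1983to89.B9SmoothHolderClassPClosure

/-!
# `Balaban1983to89.B9Thm313WholeCutLettersGXHAtPinsP` — [B9] Theorem 3.13 (p. 426), the re-cut letter `G₁∇\*_U : 𝔠_Y⁽⁰⁾ → bXH` (`Letters313Zc.gXH`) AT THE
# PRINT-WEIGHTED BOND PIN (P1′) `bXH := bHZKP (taxiB U) s ∕ bHZKPG (taxiB U) w` of `B9SmoothHolderClassP` — the (A′) twin of `…GXHAtPinsT` §2–§3 with the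
# closure `hXcl` supplied by `B9SmoothHolderClassPClosure` (the `(Lʲη)^{1−s}` gain of the (3.43)₂ probe member kept)

T. Bałaban, *Propagators for lattice gauge theories in a background field*, Commun. Math. Phys. **99** (1985) 389–434
[`Balaban1985BackgroundPropagators`, "B9"]; [4] = T. Bałaban, *Propagators and renormalization transformations for lattice gauge
theories. II*, Commun. Math. Phys. **96** (1984) 223–250 [`Balaban1984PropagatorsII`].

statement-level skeleton of published theorems with citation tags; proofs where landed; nothing here is a claim about the
Yang–Mills mass gap

THE PRINTED LOCI.  [B9] Thm 3.12 p. 423 + (3.138) p. 423 (the two words of `G₁∇\*_U`), (3.42)₃ ∕ (3.43)₂ pp. 397–398 for G₀ = G(U) (Thm 3.3 p. 399), Thm 3.13 p. 426,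
(3.40) p. 397; [4] (2.51)–(2.54) pp. 232–233, Lemma 2.1 (2.61) p. 234.

WHY THIS FILE (cell `pub-ymgap`, node N06, seat dag-n06-l g24; repair (A′) of LOCATED-U6 — n06-d g16 WORD-U6 = (A′) GO, INBOX 2026-08-29T01:09Z: their ED.65+ derives
`hletters13` at the print-weighted pin and needs the P-twin of `gXH_bHZKG_of_pins`).  §1 `hXcl_bHZKP` (the `gXH_of_closure` binder SHAPE at `bHZKP g β₀`: sup component
`cNorm (blkBK bI) 1`, probe component `cNormR (blkPK bI) (β₀−1)`, constant `(L·C + L^{1−β₀}·C_b)·e^{r(r_near+1)}`), ★★ `gXH_bHZKP_of_pins` (into ONE print-weighted member, no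
class axiom; `B₃ ≥ L·e^{ρ(r_near+1)}·(A₁ + (B_h + θ_H A₁ c))`), ★★ `gXH_bHZKPG_of_pins` (the ∀s family lands ONCE in the graded pin: `w s·(B_h s + θ_H s A₁ c) ≤ B_H`,
`B₃ ≥ L·e^{ρ(r_near+1)}·(A₁ + B_H)`) — SAME binder text as the g22 T-versions with `bHZKT … hs0.le hs1.le hs1.le ↦ bHZKP … hs0.le hs1.le`, `bHZKG … le_rfl w ↦ bHZKPG … w`.
HONEST SCOPE.  Kernel bookkeeping over landed modules; every input is a HYPOTHESIS of printed species; nothing of [B9]∕[4] asserted; no certificate edit; COUNT-NEUTRAL;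
N06 NOT discharged; nothing continuum, nothing about the mass gap.  Cell `pub-ymgap` (HUMAN RULING D-0062), Track A node N06 [B9], seat `pub-ymgap-dag-n06-l` (g24), 2026-08-29.
-/

namespace Literature.MathematicalPhysics.QuantumFieldTheory.Balaban1983to89.B9Thm313WholeCutLettersGXHAtPinsP

open Finset B6RandomWalk B6RandomWalkHom B9Thm34Ext B11SectG B9SectDSup B9SectDL2Decay B9Thm37Glue B9Thm312Whole
open B9Thm312WholeClasses B9RWSums343to347Whole B9RWSums343Holder B9PerturbationMajorantAlgebra B9PerturbationMajorantLetters
open B9Thm313WholeRgdFrom3152 B9Thm312WholeLeaf B9Thm312WholeHolder B9Thm312WholeHHolder B9Thm313WholeHolder B9Thm313Whole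
open B9Thm313WholeCutLettersSupFrom344
open B9Thm313WholeCutLettersGXHAtPinsT (gXH_of_closureE)

noncomputable section

/-! ## §1 ★★ At ONE print-weighted bond member: no class axiom -/

section Pins

open B6GlobalChartV1 (PV blkV1)
open B6Ineq2142KLevelV1 (β lvl)
open B6KLevelCensusIndexV1 (KIdx)
open B6Geom246MultiLevelTorus (geomT)
open B9GeoNormsKLevelV1 (geo9K)
open B9CoReadingCoords (XBK blkBK)
open B9CoReadingCoordsHolder (PK blkPK probeK wK w₀K)
open B9CoReadingCoordsHolderAdm (wKA)
open B9MultiscaleSmoothPartitionYNear (rNear)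
open B9SmoothHolderClassT (bHZKT)
open B9SmoothHolderClassP (bHZKP bHZKPG hasMaj_into_bHZKPG)
open B9SmoothHolderClassPClosure (hasMaj_into_bHZKP_of_probeMaj_near)
open B9MultiscaleSmoothPartitionYNear (dist_sIK_le_of_nearY)
open B9SmoothHolderClassTClosure (abs_cf_eq_nKT)
open Node00 (SiteY FBondY IBondY toKT)

variable {d ℓ : ℕ} {hd : 1 ≤ d + 1} {hL : Odd (ℓ + 1) ∧ 1 < ℓ + 1} {b₀ b₁ : ℝ}
variable {𝔸 : Type} [NormedRing 𝔸] [NormedAlgebra ℂ 𝔸]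
variable {κ : Type} [Fintype κ]
variable (i : KIdx d ℓ hd hL b₀ b₁) [Fintype (geo9K i).Site] (b : Module.Basis κ ℝ 𝔸) (gt : FBondY i → FBondY i → 𝔸ˣ)
variable {B : B9.Backgrounds} {Y Z W PY : Type} [Fintype Y] [Fintype Z] [Fintype W]
variable {R₀ : ℝ} {H₀ : Prop}

/-- ★★ **THE RE-CUT LETTER G₁∇\*_U : 𝔠_Y⁽⁰⁾ → `bXH` AT ONE PRINT-WEIGHTED MEMBER `bXH := bHZKP g β₀` — NO CLASS AXIOM.**  Under the certificate's pin equations (`𝔬.blk = blkBK bI`,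
`𝔭.blkPX = blkPK bI`, `𝔭.ΦX U β₀ = probeK b g (wKA β₀) (w₀K β₀)` — `holderProbesKA`'s family along the class's own table `g`, e.g. `taxiB U` at def-Y's `parBY`) and its
carrier binders (`hβ1 hlev hbI0`, print's units `hcfk`), `Letters313Zc.gXH`'s statement follows from Theorem 3.3's (3.42)₃ `he2` and (3.43)₂ `h43` for G₀, the steps
`hK ∕ hpX` and `Identities`, by `gXH_of_closureE` with the closure THEOREM `B9SmoothHolderClassPClosure.hasMaj_into_bHZKP_of_probeMaj_near` (`E := L`, `r_X := r_near + 1`; the `(Lʲη)^{1−β₀}` gain kept, `L^{1−β₀} ≤ L`): any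
`B₃ ≥ L·e^{ρ(r_near+1)}·(A₁ + (B_h + θ_H A₁ c))`, any `δ₃ ≤ ρ`. [cite: Balaban1985BackgroundPropagators, Thm 3.13 p.426 + Thm 3.12 p.423 ((3.138)) + (3.40)–(3.43) pp.397–398; Balaban1984PropagatorsII, (2.51)–(2.56) pp.232–233 + Lemma 2.1 (2.61) p.234] -/
theorem gXH_bHZKP_of_pins (hG : GeoOK (geo9K i)) {σ c : ℝ} (hrow : RowSum (toB6 (geo9K i) R₀ H₀) σ c)
    {𝔬 : Ops (geo9K i) B (XBK κ i) Y Z W} (𝔭 : HolderProbes (geo9K i) B (XBK κ i) Y (PK (FBondY i) (Fin (d + 1)) κ) PY)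
    {U : B.Cfg} {θ θH B₀ Bh β₀ δ₀ δK ρ B₃ δ₃ : ℝ} (hβ0 : 0 ≤ β₀) (hβ1 : β₀ ≤ 1)
    (hc : 0 ≤ c) (hθ : 0 ≤ θ) (hθH : 0 ≤ θH) (hB₀ : 0 ≤ B₀) (hBh : 0 ≤ Bh) (hρ : 0 ≤ ρ) (hρS : ρ ≤ δ₀) (hρδ : ρ + σ ≤ δK) (hq : θ * c < 1)
    {bI : FBondY i → IBondY i}
    (hβ1f : ∀ f : FBondY i, (geomT i.D).dist (β i.hN i.D i.hk (bI f)) (blkV1 i.hN i.D f) ≤ 1)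
    (hlev : ∀ f : FBondY i, lvl i.hN i.D i.hk (bI f) = (blkV1 i.hN i.D f).1.1) (hbI0 : ∀ f : FBondY i, bI f = bI ⟨f.src, 0⟩)
    (hcfk : i.cf = (((ℓ + 1 : ℕ) : ℝ)) ^ i.k)
    (hblk : 𝔬.blk = blkBK i bI) (hPX : 𝔭.blkPX = blkPK bI) (hΦ : 𝔭.ΦX U β₀ = probeK b gt (wKA i β₀) (w₀K i β₀))
    (hK : HasMaj (cNorm R₀ H₀ 𝔬.blk hG.lenle 1) (cNorm R₀ H₀ 𝔬.blk hG.lenle 1) (𝔬.G0 U ∘ₗ (𝔬.Tpi U + 𝔬.T2 U))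
      (fun a b => θ * Real.exp (-(δK * (geo9K i).dist a b))))
    (he2 : HasMajorantHom (g := toB6 (geo9K i) R₀ H₀) 𝔬.blkY 𝔬.blk (𝔬.G0 U ∘ₗ 𝔬.Dstar U)
      (fun a b => B₀ * (geo9K i).len a * Real.exp (-(δ₀ * (geo9K i).dist a b))))
    (h43 : HasMajorantHom (g := toB6 (geo9K i) R₀ H₀) 𝔬.blkY 𝔭.blkPX (𝔭.ΦX U β₀ ∘ₗ (𝔬.G0 U ∘ₗ 𝔬.Dstar U))
      (fun (a b : (geo9K i).Site) => Bh * (geo9K i).len a ^ (1 - β₀) * Real.exp (-(δ₀ * (geo9K i).dist a b))))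
    (hpX : HasMaj (cNormR R₀ H₀ 𝔬.blk hG.lenle (-1)) (cNormR R₀ H₀ 𝔭.blkPX hG.lenle (β₀ - 1))
      ((𝔭.ΦX U β₀ ∘ₗ 𝔬.G0 U) ∘ₗ (𝔬.Tpi U + 𝔬.T2 U)) (fun a b => θH * Real.exp (-(δK * (geo9K i).dist a b))))
    (hI : Identities 𝔬 U)
    (hB₃ : (((ℓ + 1 : ℕ) : ℝ)) * Real.exp (ρ * (rNear d ℓ + 1)) * (B₀ * (1 - θ * c)⁻¹ + (Bh + θH * (B₀ * (1 - θ * c)⁻¹) * c)) ≤ B₃) (hδ₃ : δ₃ ≤ ρ) :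
    HasMaj (cNorm R₀ H₀ 𝔬.blkY hG.lenle 0) (bHZKP (κ := κ) i b gt (R := R₀) (H := H₀) (s := β₀) hβ0 hβ1) (𝔬.G1 U ∘ₗ 𝔬.Dstar U)
      (fun a b => B₃ * Real.exp (-(δ₃ * (geo9K i).dist a b))) := by
  have hL1 : (1 : ℝ) ≤ ((ℓ + 1 : ℕ) : ℝ) := by exact_mod_cast Nat.succ_le_succ (Nat.zero_le ℓ)
  refine gXH_of_closureE hG hrow 𝔭 hc hθ hθH hB₀ hBh hρ hρS hρδ hq hL1 hK he2 h43 hpX hI ?_ hB₃ hδ₃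
  -- the closure at the transported pin, rewritten through the pin equations
  intro T C Cb r hC hCb hr hsupT hprT
  rw [hblk] at hsupT
  rw [hPX, hΦ] at hprT
  -- `cNorm … 1` is `cNormR … (−1)` and `cNormR … 0` is `cNorm … 0` on the nose of the local sizes
  have hsup' : HasMaj (cNorm R₀ H₀ 𝔬.blkY hG.lenle 0) (cNormR R₀ H₀ (blkBK i bI) hG.lenle (-(1 : ℝ))) T
      (fun a a' => C * Real.exp (-(r * (geo9K i).dist a a'))) := by
    intro y' μ hμ y
    have h := hsupT y' μ hμ y
    rw [cNormR_loc, Real.rpow_neg (hG.lenle y), Real.rpow_one]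
    rw [show (cNorm R₀ H₀ (blkBK i bI) hG.lenle 1).loc y (T μ) = wt (geo9K i) 1 y * (BlockNorm.ofBlocks (toB6 (geo9K i) R₀ H₀) (blkBK i bI)).loc y (T μ)
      from rfl, wt, pow_one] at h
    exact h
  have hpr' : HasMaj (cNorm R₀ H₀ 𝔬.blkY hG.lenle 0) (cNormR R₀ H₀ (blkPK bI) hG.lenle (β₀ - 1)) (probeK b gt (wKA i β₀) (w₀K i β₀) ∘ₗ T)
      (fun a a' => Cb * Real.exp (-(r * (geo9K i).dist a a'))) := by
    intro y' μ hμ y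
    have h := hprT y' μ hμ y
    have e0 : (cNormR R₀ H₀ 𝔬.blkY hG.lenle 0).loc y' μ = (cNorm R₀ H₀ 𝔬.blkY hG.lenle 0).loc y' μ := by
      rw [cNormR_loc, Real.rpow_zero, one_mul, show (cNorm R₀ H₀ 𝔬.blkY hG.lenle 0).loc y' μ =
        wt (geo9K i) 0 y' * (BlockNorm.ofBlocks (toB6 (geo9K i) R₀ H₀) 𝔬.blkY).loc y' μ from rfl, wt, pow_zero, inv_one, one_mul]
    rw [e0] at h
    exact h
  have h := hasMaj_into_bHZKP_of_probeMaj_near i b gt hG.lenle hβ0 hβ1 hβ1f hlev hbI0 hr (abs_cf_eq_nKT i hcfk) hC hCb hsup' hpr'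
  refine h.mono fun a a' => ?_
  have he : 0 ≤ Real.exp (r * (rNear d ℓ + 1)) * Real.exp (-(r * (geo9K i).dist a a')) := by positivity
  have hLs : (((ℓ + 1 : ℕ) : ℝ)) ^ (1 - β₀) ≤ ((ℓ + 1 : ℕ) : ℝ) := by
    conv_rhs => rw [← Real.rpow_one (((ℓ + 1 : ℕ) : ℝ))]
    exact Real.rpow_le_rpow_of_exponent_le hL1 (by linarith)
  have hcoef : (((ℓ + 1 : ℕ) : ℝ)) * C + (((ℓ + 1 : ℕ) : ℝ)) ^ (1 - β₀) * Cb ≤ ((ℓ + 1 : ℕ) : ℝ) * (C + Cb) := by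
    nlinarith [mul_le_mul_of_nonneg_right hLs hCb]
  calc ((((ℓ + 1 : ℕ) : ℝ)) * C + (((ℓ + 1 : ℕ) : ℝ)) ^ (1 - β₀) * Cb) * Real.exp (r * (rNear d ℓ + 1)) * Real.exp (-(r * (geo9K i).dist a a'))
      = ((((ℓ + 1 : ℕ) : ℝ)) * C + (((ℓ + 1 : ℕ) : ℝ)) ^ (1 - β₀) * Cb) * (Real.exp (r * (rNear d ℓ + 1)) * Real.exp (-(r * (geo9K i).dist a a'))) := by ring
    _ ≤ (((ℓ + 1 : ℕ) : ℝ) * (C + Cb)) * (Real.exp (r * (rNear d ℓ + 1)) * Real.exp (-(r * (geo9K i).dist a a'))) :=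
        mul_le_mul_of_nonneg_right hcoef he
    _ = _ := by ring

/-! ## §2 ★★ Into the GRADED print-weighted pin: the producer lands once -/

/-- ★★ **`Letters313Zc.gXH` AT THE GRADED PRINT-WEIGHTED PIN `bXH := bHZKPG g w`** (LOCATED-U5: the class floats its exponent, the producer lands ONCE).  Data: the sup word (3.42)₃
`he2` and the step `hK` (exponent-free), and FOR EVERY `s ∈ (0,1)` the probe words `h43 s` ((3.43)₂ for G₀ with constant `B_h s`, `B₀(β) → ∞` allowed), `hpX s`
(probe step, `θ_H s`) and the pin equation `hΦ s`; the weight absorbs the exponent-dependent constants: `w s·(B_h s + θ_H s·A₁·c) ≤ B_H`.  Conclusion: G₁∇\*_U :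
𝔠_Y⁽⁰⁾ → `bHZKPG g w` with any `B₃ ≥ L·e^{ρ(r_near+1)}·(A₁ + B_H)`, any `δ₃ ≤ ρ`.
[cite: Balaban1985BackgroundPropagators, Thm 3.1 p.397 («B₀(β) → ∞ if β → 1») + Thm 3.13 p.426 + Thm 3.12 p.423 + (3.42)–(3.43) pp.397–398; Balaban1984PropagatorsII, (2.51)–(2.56) pp.232–233] -/
theorem gXH_bHZKPG_of_pins (hG : GeoOK (geo9K i)) {σ c : ℝ} (hrow : RowSum (toB6 (geo9K i) R₀ H₀) σ c)
    {𝔬 : Ops (geo9K i) B (XBK κ i) Y Z W} (𝔭 : HolderProbes (geo9K i) B (XBK κ i) Y (PK (FBondY i) (Fin (d + 1)) κ) PY)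
    {U : B.Cfg} (w : ℝ → ℝ) (hw0 : ∀ s, 0 ≤ w s) (hw1 : ∀ s, w s ≤ 1) {θ B₀ δ₀ δK ρ B₃ δ₃ BH : ℝ} {θH Bh : ℝ → ℝ}
    (hc : 0 ≤ c) (hθ : 0 ≤ θ) (hθH : ∀ s, 0 < s → s < 1 → 0 ≤ θH s) (hB₀ : 0 ≤ B₀) (hBh : ∀ s, 0 < s → s < 1 → 0 ≤ Bh s) (hBH : 0 ≤ BH)
    (hρ : 0 ≤ ρ) (hρS : ρ ≤ δ₀) (hρδ : ρ + σ ≤ δK) (hq : θ * c < 1)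
    (hwB : ∀ s, 0 < s → s < 1 → w s * (Bh s + θH s * (B₀ * (1 - θ * c)⁻¹) * c) ≤ BH)
    {bI : FBondY i → IBondY i}
    (hβ1f : ∀ f : FBondY i, (geomT i.D).dist (β i.hN i.D i.hk (bI f)) (blkV1 i.hN i.D f) ≤ 1)
    (hlev : ∀ f : FBondY i, lvl i.hN i.D i.hk (bI f) = (blkV1 i.hN i.D f).1.1) (hbI0 : ∀ f : FBondY i, bI f = bI ⟨f.src, 0⟩)
    (hcfk : i.cf = (((ℓ + 1 : ℕ) : ℝ)) ^ i.k)
    (hblk : 𝔬.blk = blkBK i bI) (hPX : 𝔭.blkPX = blkPK bI) (hΦ : ∀ s, 0 < s → s < 1 → 𝔭.ΦX U s = probeK b gt (wKA i s) (w₀K i s))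
    (hK : HasMaj (cNorm R₀ H₀ 𝔬.blk hG.lenle 1) (cNorm R₀ H₀ 𝔬.blk hG.lenle 1) (𝔬.G0 U ∘ₗ (𝔬.Tpi U + 𝔬.T2 U))
      (fun a b => θ * Real.exp (-(δK * (geo9K i).dist a b))))
    (he2 : HasMajorantHom (g := toB6 (geo9K i) R₀ H₀) 𝔬.blkY 𝔬.blk (𝔬.G0 U ∘ₗ 𝔬.Dstar U)
      (fun a b => B₀ * (geo9K i).len a * Real.exp (-(δ₀ * (geo9K i).dist a b))))
    (h43 : ∀ s, 0 < s → s < 1 → HasMajorantHom (g := toB6 (geo9K i) R₀ H₀) 𝔬.blkY 𝔭.blkPX (𝔭.ΦX U s ∘ₗ (𝔬.G0 U ∘ₗ 𝔬.Dstar U))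
      (fun (a b : (geo9K i).Site) => Bh s * (geo9K i).len a ^ (1 - s) * Real.exp (-(δ₀ * (geo9K i).dist a b))))
    (hpX : ∀ s, 0 < s → s < 1 → HasMaj (cNormR R₀ H₀ 𝔬.blk hG.lenle (-1)) (cNormR R₀ H₀ 𝔭.blkPX hG.lenle (s - 1))
      ((𝔭.ΦX U s ∘ₗ 𝔬.G0 U) ∘ₗ (𝔬.Tpi U + 𝔬.T2 U)) (fun a b => θH s * Real.exp (-(δK * (geo9K i).dist a b))))
    (hI : Identities 𝔬 U)
    (hB₃ : (((ℓ + 1 : ℕ) : ℝ)) * Real.exp (ρ * (rNear d ℓ + 1)) * (B₀ * (1 - θ * c)⁻¹ + BH) ≤ B₃) (hδ₃ : δ₃ ≤ ρ) :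
    HasMaj (cNorm R₀ H₀ 𝔬.blkY hG.lenle 0) (bHZKPG (κ := κ) i b gt (R := R₀) (H := H₀) w hw0 hw1) (𝔬.G1 U ∘ₗ 𝔬.Dstar U)
      (fun a b => B₃ * Real.exp (-(δ₃ * (geo9K i).dist a b))) := by
  have hL0 : (0 : ℝ) ≤ ((ℓ + 1 : ℕ) : ℝ) := Nat.cast_nonneg _
  have hinv : 0 ≤ (1 - θ * c)⁻¹ := inv_nonneg.mpr (by linarith)
  have hA₁ : 0 ≤ B₀ * (1 - θ * c)⁻¹ := mul_nonneg hB₀ hinv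
  set Λ : ℝ := (((ℓ + 1 : ℕ) : ℝ)) * Real.exp (ρ * (rNear d ℓ + 1)) with hΛ
  have hΛ0 : 0 ≤ Λ := by positivity
  -- member by member, then the graded landing with `w s·K s ≤ K₀`
  have hmem : ∀ (s : ℝ) (hs0 : 0 < s) (hs1 : s < 1),
      HasMaj (cNorm R₀ H₀ 𝔬.blkY hG.lenle 0) (bHZKP (κ := κ) i b gt (R := R₀) (H := H₀) (s := s) hs0.le hs1.le)
        (𝔬.G1 U ∘ₗ 𝔬.Dstar U)
        (fun a a' => Λ * (B₀ * (1 - θ * c)⁻¹ + (Bh s + θH s * (B₀ * (1 - θ * c)⁻¹) * c)) * Real.exp (-(ρ * (geo9K i).dist a a'))) :=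
    fun s hs0 hs1 => gXH_bHZKP_of_pins i b gt hG hrow 𝔭 hs0.le hs1.le hc hθ (hθH s hs0 hs1) hB₀ (hBh s hs0 hs1) hρ hρS hρδ hq hβ1f hlev hbI0 hcfk
      hblk hPX (hΦ s hs0 hs1) hK he2 (h43 s hs0 hs1) (hpX s hs0 hs1) hI le_rfl le_rfl
  have hgr : HasMaj (cNorm R₀ H₀ 𝔬.blkY hG.lenle 0) (bHZKPG (κ := κ) i b gt (R := R₀) (H := H₀) w hw0 hw1) (𝔬.G1 U ∘ₗ 𝔬.Dstar U)
      (fun a a' => Λ * (B₀ * (1 - θ * c)⁻¹ + BH) * Real.exp (-(ρ * (geo9K i).dist a a'))) := by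
    refine hasMaj_into_bHZKPG i b gt w hw0 hw1
      (K := fun s a a' => Λ * (B₀ * (1 - θ * c)⁻¹ + (Bh s + θH s * (B₀ * (1 - θ * c)⁻¹) * c)) * Real.exp (-(ρ * (geo9K i).dist a a')))
      (fun _ _ => by positivity) (fun s hs0 hs1 a a' => ?_) hmem
    have h1 : w s * (B₀ * (1 - θ * c)⁻¹) ≤ B₀ * (1 - θ * c)⁻¹ := mul_le_of_le_one_left hA₁ (hw1 s)
    have h2 := hwB s hs0 hs1
    have he : 0 ≤ Λ * Real.exp (-(ρ * (geo9K i).dist a a')) := by positivity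
    calc w s * (Λ * (B₀ * (1 - θ * c)⁻¹ + (Bh s + θH s * (B₀ * (1 - θ * c)⁻¹) * c)) * Real.exp (-(ρ * (geo9K i).dist a a')))
        = (w s * (B₀ * (1 - θ * c)⁻¹) + w s * (Bh s + θH s * (B₀ * (1 - θ * c)⁻¹) * c)) * (Λ * Real.exp (-(ρ * (geo9K i).dist a a'))) := by ring
      _ ≤ (B₀ * (1 - θ * c)⁻¹ + BH) * (Λ * Real.exp (-(ρ * (geo9K i).dist a a'))) := mul_le_mul_of_nonneg_right (add_le_add h1 h2) he
      _ = _ := by ring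
  have hC0 : 0 ≤ Λ * (B₀ * (1 - θ * c)⁻¹ + BH) := by positivity
  exact hasMaj_weaken hG hC0 (by rw [hΛ] at *; linarith) hδ₃ hgr

end Pins

end

end Literature.MathematicalPhysics.QuantumFieldTheory.Balaban1983to89.B9Thm313WholeCutLettersGXHAtPinsP
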